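import Summits.Ventures.WeilGRH.UniformConductorFloorMinorant
import HarnessLib

/-!
# GRH arm (rh-explicit, venture WeilGRH): the minorant with the primes dividing the modulus REMOVED

Cell `rh-explicit`, WEIL TRACK — GRH ARM (weil-grh-1, gen7 «divisibility floors»).
`UniformConductorFloorMinorant.lean` proves `T_M(|g|) ≤ Re Q_χ(g)` where `T_M` (`trivialKeyFormTrunc`) is Weil's twisted
form with EVERY character value replaced by `1`.  For a character `χ` mod `q` and a prime power `n` with `(n, q) > 1`
one has `χ(n) = 0`, so those prime powers contribute NOTHING to `Q_χ`; this file records the sharper minorant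

  `T_M(|g|) + Σ_{n ≤ N, (n, m) > 1} (Λ(n)/√n)·2 c_{|g|}(log n) ≤ Re Q_χ(g)`     (`c_h(u) = ∫ h(y) h(y − u) dy`)

valid for every `χ` mod `q ≠ 1` with `m ∣ q` (`trivialKeyFormTrunc_add_killed_le_re_weilQuadraticChar`; no new definitions:
the «killed» weight is written `if n.Coprime m then 0 else Λ(n)/√n`).  Consequence
(`weilPositivityOnChar_of_trivialKeyFormTrunc_add_killed_nonneg`): if that left side is `≥ 0` at `|g|` for every test `g` on
the window at conductor parameter `Q₀`, then `WeilPositivityOnChar χ t` for EVERY character of parity `κ` of EVERY modulus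
`q ≥ Q₀` divisible by `m` — the «divisibility floor» `q*(t; m)` of the rung.  Also recorded standalone: the archimedean half
of the minorant (`digamma_layers_abs_le_arch`), which `UniformConductorFloorMinorant.lean` proves inline, and the prime half at
level `m` (`re_weilPrimeTermChar_le_sum_coprime`).

Everything here is PROVED; no definitions, no named facts; no `ζ` input; standard axioms.

## References

* A. Weil (1952), (11) with (5), (10) and the «lemme» p. 262 [Weil1952FormulesExplicites];
  H. L. Montgomery, R. C. Vaughan (2007), (12.22), Lemma 12.14 [MontgomeryVaughan2007]. [folklore]
-/

noncomputable section

open Complex Filter Set MeasureTheory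
open scoped Real Topology ComplexConjugate ArithmeticFunction.vonMangoldt

namespace Summit.Ventures.WeilGRH

open Literature.NumberTheory.LFunctions

namespace UniformFloor

variable {g : ℝ → ℂ}

/-! ## A character vanishes off the units -/

/-- `χ(n) = 0` for a Dirichlet character mod `q` when `m ∣ q` and `(n, m) > 1`. [folklore] -/
theorem dirichletCharacter_apply_eq_zero_of_not_coprime {q : ℕ} (χ : DirichletCharacter ℂ q) {m n : ℕ} (hm : m ∣ q)
    (hn : ¬ n.Coprime m) : χ (n : ZMod q) = 0 := by
  refine MulChar.map_nonunit χ fun hu ↦ hn ?_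
  exact Nat.Coprime.coprime_dvd_right hm ((ZMod.isUnit_iff_coprime n q).1 hu)

/-! ## The prime side -/

/-- **Prime side of the minorant at level `m`**: for `χ` mod `q`, `m ∣ q`, `k = g ⋆ g̃` with `g` supported in `[-t, t]` and
`e^{2t} ≤ N + 1`: `Re P_χ(k) ≤ Σ_{n ≤ N, (n,m)=1} (Λ(n)/√n) · 2∫|g(y)||g(y − log n)| dy`. [folklore] -/
theorem re_weilPrimeTermChar_le_sum_coprime {q : ℕ} (χ : DirichletCharacter ℂ q) {m : ℕ} (hm : m ∣ q)
    (hg : IsWeilTest g) {t : ℝ} (hsupp : tsupport g ⊆ Icc (-t) t) {N : ℕ} (hN : Real.exp (2 * t) ≤ (N : ℝ) + 1) :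
    (weilPrimeTermChar χ (weilConv g (weilReflect g))).re ≤
      ∑ n ∈ Finset.range (N + 1), (if n.Coprime m then (Λ n : ℝ) / Real.sqrt n else 0) *
        (2 * ∫ y : ℝ, ‖g y‖ * ‖g (y - Real.log n)‖) := by
  set k := weilConv g (weilReflect g) with hk
  have hkc : Continuous k := (hg.weilConv hg.weilReflect).1.continuous
  have hks : tsupport k ⊆ Icc (-(2 * t)) (2 * t) := tsupport_weilConv_weilReflect_subset hg.2 hsupp
  refine (Complex.re_le_norm _).trans ?_
  rw [weilPrimeTermChar_eq_sum_of_tsupport_subset χ hkc hN hks]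
  refine (norm_sum_le _ _).trans (Finset.sum_le_sum fun n _ ↦ ?_)
  have hΛ : 0 ≤ (Λ n : ℝ) / Real.sqrt n :=
    div_nonneg ArithmeticFunction.vonMangoldt_nonneg (Real.sqrt_nonneg _)
  have hcoef : ‖((Λ n : ℝ) : ℂ) / (Real.sqrt n : ℂ)‖ = (Λ n : ℝ) / Real.sqrt n := by
    rw [← Complex.ofReal_div, Complex.norm_real, Real.norm_of_nonneg hΛ]
  by_cases hn : n.Coprime m
  · rw [if_pos hn]
    have hχ : ‖χ (n : ZMod q)‖ ≤ 1 := DirichletCharacter.norm_le_one χ _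
    have hneg : ‖k (-Real.log n)‖ = ‖k (Real.log n)‖ := by
      rw [hk, weilConv_weilReflect_neg, Complex.norm_conj]
    have hkL : ‖k (Real.log n)‖ ≤ ∫ y : ℝ, ‖g y‖ * ‖g (y - Real.log n)‖ :=
      norm_weilConv_weilReflect_le_integral_mul g _
    rw [norm_mul, hcoef]
    refine mul_le_mul_of_nonneg_left ?_ hΛ
    refine (norm_add_le _ _).trans ?_
    rw [norm_mul, norm_mul, Complex.norm_conj, hneg]
    have hk0 : 0 ≤ ‖k (Real.log n)‖ := norm_nonneg _
    nlinarith [mul_le_mul_of_nonneg_right hχ hk0]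
  · rw [if_neg hn, dirichletCharacter_apply_eq_zero_of_not_coprime χ hm hn]
    simp

/-! ## The archimedean side -/

/-- **Archimedean side of the minorant** (standalone form of the inline step of
`re_weilQuadraticChar_ge_trivialKeyFormTrunc`): for `x > 0` and `M` Lévy layers,
`ψ(x)‖g‖² + Σ_{m<M} ∫ e^{−2(m+x)|u|}(‖g‖² − ∫|g(y)||g(y−u)|dy) du ≤ (1/2π)∫ |ĝ(½+iτ)|² Re ψ(x + iτ/2) dτ`.
[cite: MontgomeryVaughan2007, (12.22) and Lemma 12.14] -/
theorem digamma_layers_abs_le_arch (hg : IsWeilTest g) {x : ℝ} (hx0 : 0 < x) (M : ℕ) :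
    (digamma (x : ℂ)).re * weilNorm2Sq g + ∑ m ∈ Finset.range M,
        ∫ u : ℝ, Real.exp (-(2 * ((m : ℝ) + x) * |u|)) * (weilNorm2Sq g - ∫ y : ℝ, ‖g y‖ * ‖g (y - u)‖) ≤
      1 / (2 * π) * ∫ τ : ℝ, ‖weilMellin g (1 / 2 + τ * I)‖ ^ 2 *
        (digamma ((x : ℂ) + ((τ / 2 : ℝ) : ℂ) * I)).re := by
  set k := weilConv g (weilReflect g) with hk
  set N2 := weilNorm2Sq g with hN2
  set W : ℝ → ℝ := fun τ ↦ ‖weilMellin g (1 / 2 + τ * I)‖ ^ 2 with hW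
  set A : ℝ := ∫ τ : ℝ, W τ * (digamma ((x : ℂ) + ((τ / 2 : ℝ) : ℂ) * I)).re with hA
  have hpt : ∀ τ : ℝ, W τ * ((digamma (x : ℂ)).re) + ∑ m ∈ Finset.range M,
      W τ * (1 / ((m : ℝ) + x) - ((m : ℝ) + x) / (((m : ℝ) + x) ^ 2 + (τ / 2) ^ 2)) ≤
      W τ * (digamma ((x : ℂ) + ((τ / 2 : ℝ) : ℂ) * I)).re := by
    intro τ
    have h := re_digamma_ge_sum x hx0 M τ
    have hW0 : 0 ≤ W τ := by positivity
    rw [← Finset.mul_sum, ← mul_add]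
    exact mul_le_mul_of_nonneg_left h hW0
  have hIW : Integrable W := integrable_norm_sq_weilMellin_half_line hg
  have hIψ : Integrable fun τ : ℝ ↦ W τ * (digamma ((x : ℂ) + ((τ / 2 : ℝ) : ℂ) * I)).re := by
    refine (integrable_norm_sq_weilMellin_mul_re_digamma hg hx0).congr (Eventually.of_forall fun τ ↦ ?_)
    simp only [hW]
    congr 3
    push_cast
    ring
  have hIm : ∀ m : ℕ, Integrable fun τ : ℝ ↦
      W τ * (1 / ((m : ℝ) + x) - ((m : ℝ) + x) / (((m : ℝ) + x) ^ 2 + (τ / 2) ^ 2)) := by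
    intro m
    have hl : 0 < (m : ℝ) + x := by positivity
    have h1 : Integrable fun τ : ℝ ↦ W τ * (((m : ℝ) + x) / (((m : ℝ) + x) ^ 2 + (τ / 2) ^ 2)) :=
      integrable_norm_sq_weilMellin_mul hg (continuous_lorentz hl).measurable (A := 1 / ((m : ℝ) + x)) (B := 0)
        (by positivity) le_rfl fun τ ↦ by
          rw [abs_of_nonneg (lorentz_nonneg hl τ), zero_mul, add_zero]
          exact lorentz_le hl τ
    refine ((hIW.mul_const (1 / ((m : ℝ) + x))).sub h1).congr (Eventually.of_forall fun τ ↦ ?_)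
    simp only [Pi.sub_apply]
    ring
  have hint := integral_mono
    (f := fun τ : ℝ ↦ W τ * ((digamma (x : ℂ)).re) + ∑ m ∈ Finset.range M,
      W τ * (1 / ((m : ℝ) + x) - ((m : ℝ) + x) / (((m : ℝ) + x) ^ 2 + (τ / 2) ^ 2)))
    ((hIW.mul_const _).add (integrable_finsetSum _ fun m _ ↦ hIm m)) hIψ hpt
  rw [integral_add (hIW.mul_const _) (integrable_finsetSum _ fun m _ ↦ hIm m), integral_mul_const,
    integral_finsetSum _ (fun m _ ↦ hIm m), integral_norm_sq_weilMellin_half_line hg] at hint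
  have hlayer : ∀ m ∈ Finset.range M,
      2 * π * ∫ u : ℝ, Real.exp (-(2 * ((m : ℝ) + x) * |u|)) * (N2 - ∫ y : ℝ, ‖g y‖ * ‖g (y - u)‖) ≤
        ∫ τ : ℝ, W τ * (1 / ((m : ℝ) + x) - ((m : ℝ) + x) / (((m : ℝ) + x) ^ 2 + (τ / 2) ^ 2)) := by
    intro m _
    have hl : 0 < (m : ℝ) + x := by positivity
    have h1 := layer_eq_integral hg hl
    have h2 := layer_ge_abs hg hl
    have hπ : 0 < 2 * π := by positivity
    rw [← hN2, ← hk] at h1 h2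
    have e : ∫ τ : ℝ, W τ * (1 / ((m : ℝ) + x) - ((m : ℝ) + x) / (((m : ℝ) + x) ^ 2 + (τ / 2) ^ 2)) =
        2 * π * ∫ u : ℝ, Real.exp (-(2 * ((m : ℝ) + x) * |u|)) * (N2 - (k u).re) := by
      rw [← h1, ← mul_assoc, mul_one_div_cancel (ne_of_gt hπ), one_mul]
    rw [e]
    exact mul_le_mul_of_nonneg_left h2 hπ.le
  have hsumlayer := Finset.sum_le_sum hlayer
  rw [← Finset.mul_sum] at hsumlayer
  have hπ : 0 < 2 * π := by positivity
  rw [show 1 / (2 * π) * A = A / (2 * π) by ring, le_div_iff₀ hπ]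
  have : (2 * π * N2) * (digamma (x : ℂ)).re + 2 * π * ∑ m ∈ Finset.range M,
      ∫ u : ℝ, Real.exp (-(2 * ((m : ℝ) + x) * |u|)) * (N2 - ∫ y : ℝ, ‖g y‖ * ‖g (y - u)‖) ≤ A :=
    le_trans (by linarith) hint
  linarith

/-! ## The minorant at level `m` -/

/-- **THE ALL-TRIVIAL KEY PLUS THE KILLED PRIME POWERS MINORISES EVERY CHARACTER OF A MODULUS DIVISIBLE BY `m`.**  For `χ`
mod `q ≠ 1` of parity `κ` (`x = ¼ + κ/2`), `m ∣ q`, a test function `g` supported in `[-t, t]` and `e^{2t} ≤ N + 1`: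
`T_M(|g|) + Σ_{n ≤ N, (n,m) > 1} (Λ(n)/√n)·2∫|g(y)||g(y − log n)|dy ≤ Re Q_χ(g)` (`T_M = trivialKeyFormTrunc x q N M`): the
all-trivial-key form with the prime powers sharing a factor with `m` given back (`χ(n) = 0` there).
[cite: Weil1952FormulesExplicites, (11) pp. 261–262 and the «lemme» p. 262] -/
theorem trivialKeyFormTrunc_add_killed_le_re_weilQuadraticChar {q : ℕ} (hq : q ≠ 1) (χ : DirichletCharacter ℂ q)
    {κ : ℕ} (hκ : charParity χ = κ) {m : ℕ} (hm : m ∣ q) (hg : IsWeilTest g) {t : ℝ} (hsupp : tsupport g ⊆ Icc (-t) t)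
    {N : ℕ} (hN : Real.exp (2 * t) ≤ (N : ℝ) + 1) (M : ℕ) :
    trivialKeyFormTrunc (1 / 4 + (κ : ℝ) / 2) q N M (fun y ↦ ‖g y‖) +
        ∑ n ∈ Finset.range (N + 1), (if n.Coprime m then 0 else (Λ n : ℝ) / Real.sqrt n) *
          (2 * ∫ y : ℝ, ‖g y‖ * ‖g (y - Real.log n)‖) ≤
      (weilQuadraticChar χ g).re := by
  set x : ℝ := 1 / 4 + (κ : ℝ) / 2 with hx
  have hx0 : 0 < x := by positivity
  set A : ℝ := ∫ τ : ℝ, ‖weilMellin g (1 / 2 + τ * I)‖ ^ 2 *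
    (digamma ((x : ℂ) + ((τ / 2 : ℝ) : ℂ) * I)).re with hA
  have hre : (weilQuadraticChar χ g).re = -(weilPrimeTermChar χ (weilConv g (weilReflect g))).re +
      (1 / (2 * π) * A + weilNorm2Sq g * (Real.log q - Real.log π)) := by
    rw [weilQuadraticChar_eq_neg_prime_add hq χ hκ hg, Complex.add_re, Complex.neg_re, Complex.ofReal_re]
  have hN2eq : (∫ y : ℝ, ‖g y‖ ^ 2) = weilNorm2Sq g := rfl
  have hP := re_weilPrimeTermChar_le_sum_coprime χ hm hg hsupp hN
  have hAge := digamma_layers_abs_le_arch hg hx0 M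
  -- split the full prime sum into the coprime and the killed parts
  set c : ℕ → ℝ := fun n ↦ 2 * ∫ y : ℝ, ‖g y‖ * ‖g (y - Real.log n)‖ with hc
  have hsplit : ∑ n ∈ Finset.range (N + 1), (Λ n : ℝ) / Real.sqrt n * c n =
      ∑ n ∈ Finset.range (N + 1), (if n.Coprime m then (Λ n : ℝ) / Real.sqrt n else 0) * c n +
        ∑ n ∈ Finset.range (N + 1), (if n.Coprime m then 0 else (Λ n : ℝ) / Real.sqrt n) * c n := by
    rw [← Finset.sum_add_distrib]
    refine Finset.sum_congr rfl fun n _ ↦ ?_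
    split_ifs <;> ring
  simp only [trivialKeyFormTrunc]
  rw [hN2eq, hre]
  have hP' : (weilPrimeTermChar χ (weilConv g (weilReflect g))).re ≤
      ∑ n ∈ Finset.range (N + 1), (if n.Coprime m then (Λ n : ℝ) / Real.sqrt n else 0) * c n := by
    simpa only [hc] using hP
  have hsplit' : ∑ n ∈ Finset.range (N + 1), (Λ n : ℝ) / Real.sqrt n * (2 * ∫ y : ℝ, ‖g y‖ * ‖g (y - Real.log n)‖) =
      ∑ n ∈ Finset.range (N + 1), (if n.Coprime m then (Λ n : ℝ) / Real.sqrt n else 0) * c n +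
        ∑ n ∈ Finset.range (N + 1), (if n.Coprime m then 0 else (Λ n : ℝ) / Real.sqrt n) * c n := by
    simpa only [hc] using hsplit
  rw [hsplit']
  simp only [hc]
  linarith [hAge, hP']

/-- **FROM THE LEVEL-`m` PSEUDO-KEY TO EVERY CHARACTER OF A MODULUS DIVISIBLE BY `m`.**  If
`T_M(|g|) + Σ_{n ≤ N, (n,m) > 1} (Λ(n)/√n)·2∫|g(y)||g(y − log n)|dy ≥ 0` for every test function `g` supported in `[-t, t]`,
at conductor parameter `Q₀`, then `WeilPositivityOnChar χ t` for EVERY Dirichlet character `χ` of parity `κ` and EVERY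
modulus `q ≥ Q₀` with `m ∣ q` — the **divisibility floor** of the rung (for `m = 1` this is
`weilPositivityOnChar_of_trivialKeyFormTrunc_nonneg`). [cite: Weil1952FormulesExplicites, (11) and the «lemme» p. 262] -/
theorem weilPositivityOnChar_of_trivialKeyFormTrunc_add_killed_nonneg {q : ℕ} (hq : q ≠ 1) (χ : DirichletCharacter ℂ q)
    {κ : ℕ} (hκ : charParity χ = κ) {m : ℕ} (hm : m ∣ q) {t : ℝ} {N : ℕ} (hN : Real.exp (2 * t) ≤ (N : ℝ) + 1)
    (M : ℕ) {Q₀ : ℕ} (hQ₀ : 0 < Q₀) (hQ : Q₀ ≤ q)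
    (hpos : ∀ g : ℝ → ℂ, IsWeilTest g → tsupport g ⊆ Icc (-t) t →
      0 ≤ trivialKeyFormTrunc (1 / 4 + (κ : ℝ) / 2) Q₀ N M (fun y ↦ ‖g y‖) +
        ∑ n ∈ Finset.range (N + 1), (if n.Coprime m then 0 else (Λ n : ℝ) / Real.sqrt n) *
          (2 * ∫ y : ℝ, ‖g y‖ * ‖g (y - Real.log n)‖)) :
    WeilPositivityOnChar χ t := by
  intro g hg hsupp
  have h1 := trivialKeyFormTrunc_add_killed_le_re_weilQuadraticChar hq χ hκ hm hg hsupp hN M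
  have h2 := hpos g hg hsupp
  have hlog : Real.log Q₀ ≤ Real.log q :=
    Real.log_le_log (by exact_mod_cast hQ₀) (by exact_mod_cast hQ)
  have hN20 : 0 ≤ ∫ y : ℝ, ‖g y‖ ^ 2 := integral_nonneg fun _ ↦ by positivity
  have e : trivialKeyFormTrunc (1 / 4 + (κ : ℝ) / 2) q N M (fun y ↦ ‖g y‖) =
      trivialKeyFormTrunc (1 / 4 + (κ : ℝ) / 2) Q₀ N M (fun y ↦ ‖g y‖) +
        (Real.log q - Real.log Q₀) * ∫ y : ℝ, ‖g y‖ ^ 2 := by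
    unfold trivialKeyFormTrunc; ring
  rw [e] at h1
  nlinarith [mul_nonneg (sub_nonneg.2 hlog) hN20]

end UniformFloor

end Summit.Ventures.WeilGRH

end
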